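import Summits.Ventures.PackingBounds.Energy.FivePointRieszEightGramDataY
import Summits.Ventures.PackingBounds.Energy.FivePointRieszEightGramDataL
import Summits.Ventures.PackingBounds.Energy.FivePointRieszEightGramDataE
import Summits.Ventures.PackingBounds.Energy.GramDataCheckFast
import HarnessLib

/-!
# The 158 × 158 SOS Gram block of `e3pt-sharp-n3N5s8d8-none.json`: integer PSD checks, row chunks file 3/5 (kernel evaluation)

Framing: lottery ticket; floor = certified bounds/negative ranges. Venture `PackingBounds`, cell
`pub-packcert`, energy family E3PT (pub-packcert-energy gen 15/17; n = 3, d = 8 kernel route = KERNEL-D6 double data route, size-split).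

`decide +kernel` checks, in row chunks, the integer identity `S·Y = L Lᵀ + E` with `E` symmetric (`GramData.checkRowsF`) for the data tables
`FivePointRieszEightGramDataY/L/E`; collected with the diagonal dominance of `E` in `FivePointRieszEightGramFacts`.
-/

namespace Summit.Ventures.PackingBounds.Energy.RieszEightD8

open Summit.Ventures.PackingBounds.Energy.GramData

set_option maxRecDepth 100000 in
set_option maxHeartbeats 0 in
/-- Rows 64–79 of `S·Y = L Lᵀ + E`, `E` symmetric (kernel evaluation). -/
theorem rowsR8_64_80 : checkRowsF 158 64 80 yR8 lR8 eR8 = true := by decide +kernel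

set_option maxRecDepth 100000 in
set_option maxHeartbeats 0 in
/-- Rows 80–95 of `S·Y = L Lᵀ + E`, `E` symmetric (kernel evaluation). -/
theorem rowsR8_80_96 : checkRowsF 158 80 96 yR8 lR8 eR8 = true := by decide +kernel

end Summit.Ventures.PackingBounds.Energy.RieszEightD8
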